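import Literature.Analysis.FluidPDE.OseenKernelLineIntegrals
import HarnessLib

/-!
# The splitting `ℝ³ ≃ ℝ × ℝ²` along the second coordinate: planar part, planar embedding, Fubini

Analysis/FluidPDE support file (all results proved; definitions + `simp` API) for the planar
reduction in Step 5 of the proof of Koch–Nadirashvili–Seregin–Šverák 2009, Theorem 6.2
(arXiv:0709.3599, p. 13: the blow-up limit `w` "is independent of the `x₂`-variable", and
Theorem 5.1 with Remark 6.1 are applied "to the field `(w₁, w₃)`"), i.e. for the discharge of the
named fact `Literature.Analysis.FluidPDE.KNSS2009_typeI_rate_liouville` (`KNSSTypeIRateCore`)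
from Theorem 5.1 (`KNSSTypeIRateLiouville`). In Lean's indexing the invariant variable is the
coordinate `1` of `ℝ³ = EuclideanSpace ℝ (Fin 3)` (the fact's hypothesis
`W t (x + EuclideanSpace.single 1 δ) = W t x`), and the plane of the reduced field is spanned by
the coordinates `0, 2`. This file provides that bookkeeping:

* `sideSplit : ℝ³ ≃ᵐ ℝ × ℝ²`, `x ↦ (x₁, (x₀, x₂))`, volume preserving (`measurePreserving_sideSplit`;
  the twin of `cylSplit` of `CylindricalIntegration`, which splits off the coordinate `2`);
* the planar part `sidePlane : ℝ³ →L[ℝ] ℝ²` (`P x = (x₀, x₂)`), the planar embedding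
  `sideEmbed : ℝ² →L[ℝ] ℝ³` (`ι w = (w₀, 0, w₁)`) and the axial unit vector `sideAxis = e₁`, with
  `sideSplit.symm (t, v) = ι v + t • e₁`, `P ∘ ι = id`, `‖P v‖ ≤ ‖v‖`, Pythagoras and the inner
  product along the splitting;
* Fubini along the splitting with the fibres inside (`integral_eq_integral_integral_sideSplit`,
  `integrable_integral_fiber`), continuity of `sideSplit.symm`, and `ι (P y) + y₁ e₁ = y`.

The analysis (heat kernel and Oseen kernel along the fibres, the planar reduction of the Oseen
identity) is in `HeatKernelSideFibre`, `OseenKernelSideFibre`, `OseenPlanarReduction`.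

## Mathlib / tree search

The tree already parametrises `ℝ³` by the same lines for the same step of KNSS's proof:
`OseenKernelLineIntegrals` (§R3) proves `exists_measurableEquiv_line` — the existence of a
volume-preserving `Φ : ℝ³ ≃ᵐ ℝ × ℝ²` with `Φ⁻¹(r, w) = toLp 2 ![w 0, r, w 1]`, built from the
same Mathlib pieces (`MeasurableEquiv.piFinSuccAbove` at the index `1` conjugated by
`EuclideanSpace.volume_preserving_symm_measurableEquiv_toLp`, `PiLp.volume_preserving_toLp`) —,
the Fubini theorem `integral_eq_integral_integral_line` along these lines, and `toLp_line_eq`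
(`(w₀, r, w₁) = (w₀, 0, w₁) + r e₁`). The present file NAMES that equivalence: `sideSplit` is a
witness of `exists_measurableEquiv_line` (`sideSplit_symm_apply`, `measurePreserving_sideSplit`),
`integral_eq_integral_integral_sideSplit` is `integral_eq_integral_integral_line` rewritten
through `sideSplit_symm_apply` (and is derived from it), and `sideSplit_symm_eq_sideEmbed_add_smul`
is `toLp_line_eq`; together with `inner_sideEmbed_single`, `norm_sideEmbed` and
`norm_single_one_one` this lets the line lemmas of that file (`‖e‖ = 1`, base point `⊥ e`) act on
the fibres of `sideSplit` (`HeatKernelSideFibre`). What the named splitting adds is the linear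
structure the planar reduction needs and the existential does not give: the planar part `P` and
the embedding `ι` as continuous linear maps (to push through Bochner integrals and caloric
extensions, `ContinuousLinearMap.integral_comp_comm`, `heatExtension_clm_comp_of_bound`), the
reconstruction `ι (P y) + y₁ e₁ = y`, and the measurable equivalence itself (to transport
integrability, `integrable_integral_fiber`). The cylindrical splitting at the index `2` is
`cylSplit` (`CylindricalIntegration`).

## References

* G. Koch, N. Nadirashvili, G. Seregin, V. Šverák, *Liouville theorems for the Navier–Stokes
  equations and applications*, Acta Math. 203 (2009) 83–105 = arXiv:0709.3599: proof of
  Theorem 6.2, p. 13 ("since the solutions `v⁽ᵏ⁾` are axi-symmetric and `M_k ↗ ∞`, it is easy to see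
  that `w` is independent of the `x₂`-variable. Applying Theorem 5.1 and Remark 6.1 to the field
  `(w₁, w₃)`, we conclude that `(w₁, w₃)` must vanish identically, and this easily implies that
  `w = 0`"); §3, p. 6 (the kernel `K_{ijk}` of the representation formula (3.3)); §4, p. 8 (the
  bilinear form `B`). [KochNadirashviliSereginSverak2009]
-/

noncomputable section

open MeasureTheory Set Function Filter WithLp Real
open scoped RealInnerProductSpace ENNReal NNReal

namespace Literature.Analysis.FluidPDE

/-- Local notation for physical space `ℝ³ = EuclideanSpace ℝ (Fin 3)`. -/
local notation "ℝ³" => EuclideanSpace ℝ (Fin 3)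

/-- Local notation for the plane `ℝ² = EuclideanSpace ℝ (Fin 2)`. -/
local notation "ℝ²" => EuclideanSpace ℝ (Fin 2)

/-- The measurable equivalence `ℝ³ ≃ᵐ ℝ × ℝ²`, `x ↦ (x₁, (x₀, x₂))`. [folklore] -/
def sideSplit : ℝ³ ≃ᵐ ℝ × ℝ² :=
  ((MeasurableEquiv.toLp 2 (Fin 3 → ℝ)).symm.trans
    (MeasurableEquiv.piFinSuccAbove (fun _ => ℝ) 1)).trans
    (MeasurableEquiv.prodCongr (MeasurableEquiv.refl ℝ) (MeasurableEquiv.toLp 2 (Fin 2 → ℝ)))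

/-- The first component of `sideSplit x` is the coordinate `x₁` (the variable the fields of KNSS 2009,
proof of Thm 6.2, do not depend on). [folklore] -/
@[simp] theorem sideSplit_apply_fst (x : ℝ³) : (sideSplit x).1 = x 1 := rfl

/-- The planar component of `sideSplit x` has coordinates `(x₀, x₂)`. [folklore] -/
@[simp] theorem sideSplit_apply_snd_apply (x : ℝ³) (j : Fin 2) :
    (sideSplit x).2 j = x (Fin.succAbove 1 j) := rfl

/-- The forward map on a vector written in coordinates: `sideSplit (w₀, r, w₁) = (r, w)`. [folklore] -/
theorem sideSplit_toLp (r : ℝ) (w : ℝ²) : sideSplit (toLp 2 ![w 0, r, w 1]) = (r, w) := by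
  refine Prod.ext rfl ?_
  ext j
  fin_cases j <;> rfl

/-- The inverse: `sideSplit.symm (r, w) = (w₀, r, w₁)`. [folklore] -/
theorem sideSplit_symm_apply (r : ℝ) (w : ℝ²) :
    sideSplit.symm (r, w) = toLp 2 ![w 0, r, w 1] := by
  apply sideSplit.injective
  rw [MeasurableEquiv.apply_symm_apply, sideSplit_toLp]

/-- The coordinate `x₁` of `sideSplit.symm (r, w)` is `r`. [folklore] -/
@[simp] theorem sideSplit_symm_apply_one (r : ℝ) (w : ℝ²) : sideSplit.symm (r, w) 1 = r := by
  rw [sideSplit_symm_apply]; rfl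

/-- The coordinate `x₀` of `sideSplit.symm (r, w)` is `w₀`. [folklore] -/
@[simp] theorem sideSplit_symm_apply_zero (r : ℝ) (w : ℝ²) : sideSplit.symm (r, w) 0 = w 0 := by
  rw [sideSplit_symm_apply]; rfl

/-- The coordinate `x₂` of `sideSplit.symm (r, w)` is `w₁`. [folklore] -/
@[simp] theorem sideSplit_symm_apply_two (r : ℝ) (w : ℝ²) : sideSplit.symm (r, w) 2 = w 1 := by
  rw [sideSplit_symm_apply]; rfl

/-- `sideSplit` preserves Lebesgue measure (a coordinate permutation composed with the volume-
preserving identifications `EuclideanSpace ℝ (Fin n) ≃ (Fin n → ℝ)`). [folklore] -/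
theorem measurePreserving_sideSplit : MeasurePreserving sideSplit volume volume := by
  have h1 : MeasurePreserving (MeasurableEquiv.toLp 2 (Fin 3 → ℝ)).symm volume volume :=
    EuclideanSpace.volume_preserving_symm_measurableEquiv_toLp (Fin 3)
  have h2 : MeasurePreserving (MeasurableEquiv.piFinSuccAbove (fun _ : Fin 3 => ℝ) 1) volume
      volume :=
    volume_preserving_piFinSuccAbove (fun _ => ℝ) 1
  have h3 : MeasurePreserving
      (MeasurableEquiv.prodCongr (MeasurableEquiv.refl ℝ) (MeasurableEquiv.toLp 2 (Fin 2 → ℝ)))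
      volume volume :=
    (MeasurePreserving.id volume).prod (PiLp.volume_preserving_toLp (Fin 2))
  exact (h1.trans h2).trans h3

/-- `sideSplit.symm` preserves Lebesgue measure. [folklore] -/
theorem measurePreserving_sideSplit_symm : MeasurePreserving sideSplit.symm volume volume :=
  measurePreserving_sideSplit.symm _

/-- The planar part `P x = (x₀, x₂)` as a continuous linear map. [folklore] -/
def sidePlane : ℝ³ →L[ℝ] ℝ² :=
  LinearMap.toContinuousLinearMap
    { toFun := fun x => (sideSplit x).2
      map_add' := fun x y => by ext j; rfl
      map_smul' := fun c x => by ext j; rfl }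

/-- Coordinates of the planar part: `(P x)_j = x_{σ(j)}`, `σ = Fin.succAbove 1` (`0 ↦ 0`, `1 ↦ 2`).
[folklore] -/
@[simp] theorem sidePlane_apply_apply (x : ℝ³) (j : Fin 2) :
    sidePlane x j = x (Fin.succAbove 1 j) := rfl

/-- The planar component of `sideSplit` is the planar part `P`. [folklore] -/
theorem sideSplit_apply_snd (x : ℝ³) : (sideSplit x).2 = sidePlane x := rfl

/-- `P (sideSplit.symm (r, w)) = w`. [folklore] -/
@[simp] theorem sidePlane_sideSplit_symm (r : ℝ) (w : ℝ²) :
    sidePlane (sideSplit.symm (r, w)) = w := by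
  have := sideSplit.apply_symm_apply (r, w)
  rw [Prod.ext_iff] at this
  exact this.2

/-- Every `x` is recovered from its vertical coordinate and its planar part: `sideSplit.symm (x₁, P x)
= x`. [folklore] -/
theorem sideSplit_symm_fst_sidePlane (x : ℝ³) : sideSplit.symm (x 1, sidePlane x) = x := by
  have : (x 1, sidePlane x) = sideSplit x := rfl
  rw [this, MeasurableEquiv.symm_apply_apply]

/-- Pythagoras along the splitting: `‖sideSplit.symm (r, w)‖² = r² + ‖w‖²`. [folklore] -/
theorem norm_sq_sideSplit_symm (r : ℝ) (w : ℝ²) :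
    ‖sideSplit.symm (r, w)‖ ^ 2 = r ^ 2 + ‖w‖ ^ 2 := by
  rw [EuclideanSpace.norm_sq_eq, EuclideanSpace.norm_sq_eq, Fin.sum_univ_three, Fin.sum_univ_two]
  simp [Real.norm_eq_abs, sq_abs]
  ring

/-- Inner products along the splitting: `⟪sideSplit.symm (r, w), a⟫ = r a₁ + ⟪w, P a⟫`. [folklore] -/
theorem inner_sideSplit_symm (r : ℝ) (w : ℝ²) (a : ℝ³) :
    ⟪sideSplit.symm (r, w), a⟫ = r * a 1 + ⟪w, sidePlane a⟫ := by
  simp only [EuclideanSpace.inner_eq_star_dotProduct, dotProduct, Fin.sum_univ_three,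
    Fin.sum_univ_two]
  simp
  ring

/-- `sideSplit.symm` is additive (coordinatewise): differences split componentwise. [folklore] -/
theorem sideSplit_symm_sub (r r' : ℝ) (w w' : ℝ²) :
    sideSplit.symm (r, w) - sideSplit.symm (r', w') = sideSplit.symm (r - r', w - w') := by
  ext i
  fin_cases i <;> simp

/-- The planar part does not increase the norm: `‖P v‖ ≤ ‖v‖`. [folklore] -/
theorem norm_sidePlane_le (v : ℝ³) : ‖sidePlane v‖ ≤ ‖v‖ := by
  have h := norm_sq_sideSplit_symm (v 1) (sidePlane v)
  rw [sideSplit_symm_fst_sidePlane] at h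
  have h2 : ‖sidePlane v‖ ^ 2 ≤ ‖v‖ ^ 2 := by nlinarith [sq_nonneg (v 1)]
  exact le_of_sq_le_sq h2 (norm_nonneg v)


/-! ### The axial unit vector and the planar embedding -/

/-- The planar embedding `ι w = (w₀, 0, w₁)` as a continuous linear map. [folklore] -/
def sideEmbed : ℝ² →L[ℝ] ℝ³ :=
  LinearMap.toContinuousLinearMap
    { toFun := fun w => sideSplit.symm (0, w)
      map_add' := fun w w' => by ext i; fin_cases i <;> simp
      map_smul' := fun c w => by ext i; fin_cases i <;> simp }

/-- The planar embedding in terms of the splitting: `ι w = sideSplit.symm (0, w)`. [folklore] -/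
theorem sideEmbed_apply (w : ℝ²) : sideEmbed w = sideSplit.symm (0, w) := rfl

/-- The axial unit vector `e₁ = (0, 1, 0)`, spelled as Mathlib's `EuclideanSpace.single 1 1` (the
spelling of the target fact's hypothesis `W t (x + EuclideanSpace.single 1 δ) = W t x` and of
`OseenKernelLineIntegrals`, §R3). [folklore] -/
def sideAxis : ℝ³ := EuclideanSpace.single 1 1

/-- `sideAxis` is `EuclideanSpace.single 1 1` (definitional; recorded for rewriting). [folklore] -/
theorem sideAxis_eq_single : sideAxis = EuclideanSpace.single 1 1 := rfl

/-- `EuclideanSpace.single 1 r = r • e₁` (`OseenKernelLineIntegrals.single_one_eq_smul`, restated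
with the named axis). [folklore] -/
theorem single_one_eq_smul_sideAxis (r : ℝ) :
    (EuclideanSpace.single (1 : Fin 3) r : ℝ³) = r • sideAxis :=
  single_one_eq_smul r

/-- The axial unit vector is the point `(0, 1, 0)` of the splitting: `e₁ = sideSplit.symm (1, 0)`.
[folklore] -/
theorem sideAxis_eq_sideSplit_symm : sideAxis = sideSplit.symm (1, 0) := by
  ext i
  fin_cases i <;> simp [sideAxis]

/-- The axial unit vector has `x₁ = 1`. [folklore] -/
@[simp] theorem sideAxis_apply_one : sideAxis 1 = 1 := by simp [sideAxis]
/-- The axial unit vector has `x₀ = 0`. [folklore] -/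
@[simp] theorem sideAxis_apply_zero : sideAxis 0 = 0 := by simp [sideAxis]
/-- The axial unit vector has `x₂ = 0`. [folklore] -/
@[simp] theorem sideAxis_apply_two : sideAxis 2 = 0 := by simp [sideAxis]
/-- The planar embedding has vanishing vertical coordinate. [folklore] -/
@[simp] theorem sideEmbed_apply_one (w : ℝ²) : sideEmbed w 1 = 0 := by simp [sideEmbed_apply]
/-- `(ι w)₀ = w₀`. [folklore] -/
@[simp] theorem sideEmbed_apply_zero (w : ℝ²) : sideEmbed w 0 = w 0 := by
  simp [sideEmbed_apply]
/-- `(ι w)₂ = w₁`. [folklore] -/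
@[simp] theorem sideEmbed_apply_two (w : ℝ²) : sideEmbed w 2 = w 1 := by
  simp [sideEmbed_apply]

/-- `sideSplit.symm (t, v) = ι v + t • e₁`. [folklore] -/
theorem sideSplit_symm_eq_add (t : ℝ) (v : ℝ²) :
    sideSplit.symm (t, v) = sideEmbed v + t • sideAxis := by
  ext i
  fin_cases i <;> simp [sideAxis]

/-- The planar embedding in coordinates: `ι w = (w₀, 0, w₁)` (the base point `toLp 2 ![w 0, 0, w 1]`
of the lines of `OseenKernelLineIntegrals`, §R3). [folklore] -/
theorem sideEmbed_eq_toLp (w : ℝ²) : sideEmbed w = toLp 2 ![w 0, 0, w 1] := by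
  rw [sideEmbed_apply, sideSplit_symm_apply]

/-- **The fibres of the splitting are the lines of `OseenKernelLineIntegrals`**:
`sideSplit.symm (r, w) = (w₀, 0, w₁) + r e₁` (`toLp_line_eq` of that file, through
`sideSplit_symm_apply`), so that its line lemmas (`‖e‖ = 1`, base point `⊥ e`) apply to the fibres
with `e = e₁ = sideAxis`, `z' = ι w`. [folklore] -/
theorem sideSplit_symm_eq_sideEmbed_add_smul (r : ℝ) (w : ℝ²) :
    sideSplit.symm (r, w) = sideEmbed w + r • EuclideanSpace.single (1 : Fin 3) (1 : ℝ) := by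
  rw [sideSplit_symm_apply, toLp_line_eq, sideEmbed_eq_toLp]

/-- The planar embedding is orthogonal to the axis: `⟪ι w, e₁⟫ = 0`
(`inner_toLp_base_single` of `OseenKernelLineIntegrals`). [folklore] -/
theorem inner_sideEmbed_single (w : ℝ²) :
    ⟪sideEmbed w, EuclideanSpace.single (1 : Fin 3) (1 : ℝ)⟫ = 0 := by
  rw [sideEmbed_eq_toLp]
  exact inner_toLp_base_single w

/-- The planar embedding is an isometry: `‖ι w‖ = ‖w‖`. [folklore] -/
theorem norm_sideEmbed (w : ℝ²) : ‖sideEmbed w‖ = ‖w‖ := by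
  have h := norm_sq_sideSplit_symm 0 w
  rw [← sideEmbed_apply] at h
  simp only [ne_eq, OfNat.ofNat_ne_zero, not_false_eq_true, zero_pow, zero_add] at h
  exact (pow_left_inj₀ (norm_nonneg _) (norm_nonneg _) two_ne_zero).1 h

/-- `P ∘ ι = id`. [folklore] -/
@[simp] theorem sidePlane_sideEmbed (w : ℝ²) : sidePlane (sideEmbed w) = w := by
  rw [sideEmbed_apply, sidePlane_sideSplit_symm]

/-- The planar part of the axial unit vector vanishes. [folklore] -/
@[simp] theorem sidePlane_sideAxis : sidePlane sideAxis = 0 := by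
  rw [sideAxis_eq_sideSplit_symm, sidePlane_sideSplit_symm]

/-- `⟪a, b⟫ = a₁ b₁ + ⟪Pa, Pb⟫`. [folklore] -/
theorem inner_eq_planar (a b : ℝ³) : ⟪a, b⟫ = a 1 * b 1 + ⟪sidePlane a, sidePlane b⟫ := by
  have := inner_sideSplit_symm (a 1) (sidePlane a) b
  rwa [sideSplit_symm_fst_sidePlane] at this

/-- `⟪sideSplit.symm (r, w), sideSplit.symm (t, v)⟫ = r t + ⟪w, v⟫`. [folklore] -/
theorem inner_sideSplit_symm_sideSplit_symm (r t : ℝ) (w v : ℝ²) :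
    ⟪sideSplit.symm (r, w), sideSplit.symm (t, v)⟫ = r * t + ⟪w, v⟫ := by
  rw [inner_sideSplit_symm, sideSplit_symm_apply_one, sidePlane_sideSplit_symm]


/-! ### Fubini along the splitting -/

section Fields

variable {X : Type*} [NormedAddCommGroup X] [NormedSpace ℝ X]

/-- Change of variables: `∫ F dy = ∫ F (sideSplit.symm p) dp`. [folklore] -/
theorem integral_eq_integral_sideSplit (F : ℝ³ → X) :
    ∫ y, F y = ∫ p : ℝ × ℝ², F (sideSplit.symm p) :=
  (measurePreserving_sideSplit_symm.integral_comp sideSplit.symm.measurableEmbedding F).symm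

omit [NormedSpace ℝ X] in
/-- Integrability transfers along `sideSplit.symm`. [folklore] -/
theorem integrable_comp_sideSplit_symm_iff {F : ℝ³ → X} :
    Integrable (fun p : ℝ × ℝ² => F (sideSplit.symm p)) ↔ Integrable F :=
  measurePreserving_sideSplit_symm.integrable_comp_emb sideSplit.symm.measurableEmbedding

/-- **Fubini along the splitting**, fibres inside: `∫ F dy = ∫ dw ∫ dr F (sideSplit.symm (r, w))`.
This is `integral_eq_integral_integral_line` of `OseenKernelLineIntegrals` (stated there with the
fibre written `toLp 2 ![w 0, r, w 1]`), rewritten through `sideSplit_symm_apply`. [folklore] -/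
theorem integral_eq_integral_integral_sideSplit {F : ℝ³ → X} (hF : Integrable F) :
    ∫ y, F y = ∫ w : ℝ², ∫ r : ℝ, F (sideSplit.symm (r, w)) := by
  simp_rw [sideSplit_symm_apply]
  exact integral_eq_integral_integral_line hF

/-- The fibre integrals of an integrable function are integrable on the plane. [folklore] -/
theorem integrable_integral_fiber {F : ℝ³ → X} (hF : Integrable F) :
    Integrable (fun w : ℝ² => ∫ r : ℝ, F (sideSplit.symm (r, w))) :=
  (integrable_comp_sideSplit_symm_iff.2 hF).integral_prod_right

end Fields

/-! ### Continuity of the splitting and the reconstruction of a vector -/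

/-- Every vector is its planar part embedded plus its axial component: `ι (P y) + y₁ • e₁ = y`.
[folklore] -/
theorem sideEmbed_sidePlane_add_smul_sideAxis (y : ℝ³) :
    sideEmbed (sidePlane y) + y 1 • sideAxis = y := by
  ext i
  fin_cases i <;> simp [sideAxis]

/-- The same reconstruction with the axial component spelled `EuclideanSpace.single 1 (y 1)`, the
form of the vertical translations in the hypothesis of `KNSS2009_typeI_rate_liouville`:
`ι (P y) + single 1 y₁ = y`. [folklore] -/
theorem sideEmbed_sidePlane_add_single (y : ℝ³) :
    sideEmbed (sidePlane y) + EuclideanSpace.single 1 (y 1) = y := by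
  rw [single_one_eq_smul_sideAxis]
  exact sideEmbed_sidePlane_add_smul_sideAxis y

/-- `sideSplit.symm` is continuous. [folklore] -/
theorem continuous_sideSplit_symm : Continuous (fun p : ℝ × ℝ² => sideSplit.symm p) := by
  have : (fun p : ℝ × ℝ² => sideSplit.symm p) = fun p => sideEmbed p.2 + p.1 • sideAxis :=
    funext fun p => sideSplit_symm_eq_add p.1 p.2
  rw [this]
  fun_prop

end Literature.Analysis.FluidPDE

end
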